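import Summits.Schanuel.Schanuel.Theorems.ZilberEacParamCurveLogRayRootsPos
import Summits.Schanuel.Schanuel.Theorems.ZilberEacParamCurveRayRoots
import HarnessLib

/-!
# Polynomially parametrised base curves, XXXIV: the root package with SUB-LEADING decay of the
# escape coordinate on the small discs (towards curved real lines)

HONEST FRAMING.  Cell `pub-schanuel` (Zilber's Exponential-Algebraic Closedness, case ladder;
host summit Schanuel), seat 2, gen 20.  When the leading real part `Re(lc(G) ω^n)` of the escape
polynomial `G` VANISHES on the root direction (equal degrees with real leading ratio: both
coordinates do), the decay of `e^{G}` along the roots `z₀(j) = ρ_j ω + τ + o(1)` of file XXVIII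
comes from the next order: uniformly on `‖z - z₀(j)‖ ≤ 2/(‖lc(R)‖ ‖z₀(j)‖^{d-1})`,
`Re G(z) ≤ (c/2) ρ_j^{n-1}` with `c = Re((G_{n-1} + n lc(G) τ) ω^{n-1}) < 0`
(`abs_re_eval_sub_le_of_subleading`: explicit second-order Taylor estimate with a Lipschitz
bound in the displacement `Y - τ`).  Packaged in the format consumed by the engine of file XXXIII
(`exists_ray_roots_log_sub`).  Mantova–Masser's question is OPEN in general (PLMS 2024 §1 p. 5);
NOT Schanuel's conjecture (neither used nor implied; EAC ⇏ SC); `EC(3,2)` stays OPEN.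
-/

noncomputable section

open Filter Topology Metric Set Complex Polynomial
open Literature.ModelTheory.Zilber
open Literature.Geometry.Symplectic.RotationBranch (norm_pow_sub_pow_le)

set_option linter.dupNamespace false

namespace Summit.Schanuel.Schanuel.Theorems

/-- **Pointwise second-order estimate with explicit constants.**  `deg G = m + 2 = n`, `b = lc(G)`,
`b' = G_{n-1}`, `Re(b ω^n) = 0`, `c = Re((b' + n b τ) ω^{n-1})`; for `ρ ≥ 1` and
`‖Y - τ‖ ≤ 1`:
`|Re G(ρω + Y) - c ρ^{n-1}| ≤ n ‖b‖ ‖ω‖^{n-1} ‖Y - τ‖ ρ^{n-1} + K ρ^{n-2}` and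
`‖G(ρω + Y)‖ ≤ C₁ ρ^{n}`, with `K`, `C₁` depending on `G, ω, τ` only. (new) -/
theorem abs_re_eval_sub_le_of_subleading (G : Polynomial ℂ) {m : ℕ} (hm : G.natDegree = m + 2)
    (ω τ : ℂ) (hre0 : (G.leadingCoeff * ω ^ (m + 2)).re = 0) {ρ : ℝ} (hρ : 1 ≤ ρ) {Y : ℂ}
    (hY : ‖Y - τ‖ ≤ 1) :
    |(G.eval ((ρ : ℂ) * ω + Y)).re -
        ((G.coeff (m + 1) + ((m + 2 : ℕ) : ℂ) * G.leadingCoeff * τ) * ω ^ (m + 1)).re *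
          ρ ^ (m + 1)| ≤
      ((m + 2 : ℕ) : ℝ) * ‖G.leadingCoeff‖ * ‖ω‖ ^ (m + 1) * ‖Y - τ‖ * ρ ^ (m + 1) +
        (‖G.leadingCoeff‖ * ((m + 2 : ℕ) : ℝ) ^ 2 * (‖τ‖ + 1) ^ 2 +
          ‖G.coeff (m + 1)‖ * ((m + 1 : ℕ) : ℝ) * (‖τ‖ + 1) +
          coeffNormSum (G.eraseLead - Polynomial.C (G.coeff (m + 1)) * Polynomial.X ^ (m + 1))) *
          (‖ω‖ + ‖τ‖ + 2) ^ m * ρ ^ m ∧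
      ‖G.eval ((ρ : ℂ) * ω + Y)‖ ≤ coeffNormSum G * (‖ω‖ + ‖τ‖ + 2) ^ (m + 2) * ρ ^ (m + 2) := by
  -- names
  obtain ⟨b, hb_def⟩ : ∃ b : ℂ, b = G.leadingCoeff := ⟨_, rfl⟩
  obtain ⟨b', hb'_def⟩ : ∃ b' : ℂ, b' = G.coeff (m + 1) := ⟨_, rfl⟩
  rw [← hb_def] at hre0 ⊢
  rw [← hb'_def]
  obtain ⟨ℓ₂, hℓ₂_def⟩ : ∃ ℓ₂ : Polynomial ℂ,
      ℓ₂ = G.eraseLead - Polynomial.C b' * Polynomial.X ^ (m + 1) := ⟨_, rfl⟩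
  rw [← hℓ₂_def]
  have hℓ₂deg : ℓ₂.natDegree ≤ m := by rw [hℓ₂_def, hb'_def]; exact natDegree_sublead_le G hm
  have hρ0 : 0 ≤ ρ := zero_le_one.trans hρ
  set Y₀ : ℝ := ‖τ‖ + 1 with hY₀
  have hYle : ‖Y‖ ≤ Y₀ := by
    have := norm_le_insert' Y τ
    rw [hY₀]; linarith
  set L : ℝ := ‖ω‖ + ‖τ‖ + 2 with hL
  have hL1 : 1 ≤ L := by rw [hL]; linarith [norm_nonneg ω, norm_nonneg τ]
  set X : ℂ := (ρ : ℂ) * ω with hX_def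
  set t : ℂ := X + Y with ht_def
  have hXnorm : ‖X‖ = ρ * ‖ω‖ := by
    rw [hX_def, norm_mul, Complex.norm_real, Real.norm_eq_abs, abs_of_nonneg hρ0]
  set M : ℝ := ρ * L with hM_def
  have hM1 : 1 ≤ M := one_le_mul_of_one_le_of_one_le hρ hL1
  have hXM : ‖X‖ ≤ M := by
    rw [hXnorm, hM_def]
    exact mul_le_mul_of_nonneg_left (by rw [hL]; linarith [norm_nonneg τ]) hρ0
  have htM : ‖t‖ ≤ M := by
    rw [ht_def]
    calc ‖X + Y‖ ≤ ‖X‖ + ‖Y‖ := norm_add_le _ _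
      _ ≤ ρ * ‖ω‖ + Y₀ := by rw [hXnorm]; linarith
      _ ≤ ρ * ‖ω‖ + ρ * Y₀ := by nlinarith [show (0:ℝ) ≤ Y₀ by positivity]
      _ ≤ M := by rw [hM_def, hL, hY₀]; nlinarith
  -- Taylor remainders
  have hR₁ := norm_pow_sub_pow_sub_mul_le htM hXM m
  have hR₂ := norm_pow_sub_pow_le htM hXM (m + 1)
  simp only [Nat.add_sub_cancel] at hR₂
  rw [show t - X = Y by rw [ht_def]; ring] at hR₁ hR₂
  have hℓ₂n : ‖ℓ₂.eval t‖ ≤ coeffNormSum ℓ₂ * M ^ m := norm_eval_le_of_natDegree_le ℓ₂ hM1 htM hℓ₂deg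
  -- decomposition
  have hdec := eval_eq_lead_add_sublead_add G hm t
  rw [← hb_def, ← hb'_def, ← hℓ₂_def] at hdec
  have hXpow : X ^ (m + 1) = ((ρ ^ (m + 1) : ℝ) : ℂ) * ω ^ (m + 1) := by
    rw [hX_def, mul_pow]; push_cast; ring
  have hXpow2 : X ^ (m + 2) = ((ρ ^ (m + 2) : ℝ) : ℂ) * ω ^ (m + 2) := by
    rw [hX_def, mul_pow]; push_cast; ring
  set junk : ℂ := b * (t ^ (m + 2) - X ^ (m + 2) - ((m + 2 : ℕ) : ℂ) * X ^ (m + 1) * Y) +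
    b' * (t ^ (m + 1) - X ^ (m + 1)) + ℓ₂.eval t with hjunk
  have hsplit : G.eval t = b * ω ^ (m + 2) * ((ρ ^ (m + 2) : ℝ) : ℂ) +
      ((b' + ((m + 2 : ℕ) : ℂ) * b * τ) * ω ^ (m + 1)) * ((ρ ^ (m + 1) : ℝ) : ℂ) +
      (((m + 2 : ℕ) : ℂ) * b * (Y - τ) * ω ^ (m + 1)) * ((ρ ^ (m + 1) : ℝ) : ℂ) + junk := by
    rw [hdec, hjunk]
    have e1 : b * t ^ (m + 2) = b * X ^ (m + 2) + ((m + 2 : ℕ) : ℂ) * b * X ^ (m + 1) * Y +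
        b * (t ^ (m + 2) - X ^ (m + 2) - ((m + 2 : ℕ) : ℂ) * X ^ (m + 1) * Y) := by ring
    have e2 : b' * t ^ (m + 1) = b' * X ^ (m + 1) + b' * (t ^ (m + 1) - X ^ (m + 1)) := by ring
    rw [e1, e2, hXpow, hXpow2]
    ring
  have hjunk_le : ‖junk‖ ≤ (‖b‖ * ((m + 2 : ℕ) : ℝ) ^ 2 * Y₀ ^ 2 + ‖b'‖ * ((m + 1 : ℕ) : ℝ) * Y₀ +
      coeffNormSum ℓ₂) * L ^ m * ρ ^ m := by
    have hMm : M ^ m = ρ ^ m * L ^ m := by rw [hM_def, mul_pow]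
    have h1' : ‖b * (t ^ (m + 2) - X ^ (m + 2) - ((m + 2 : ℕ) : ℂ) * X ^ (m + 1) * Y)‖ ≤
        ‖b‖ * (((m + 2 : ℕ) : ℝ) ^ 2 * M ^ m * Y₀ ^ 2) := by
      rw [norm_mul]
      refine mul_le_mul_of_nonneg_left (hR₁.trans ?_) (norm_nonneg b)
      exact mul_le_mul_of_nonneg_left (pow_le_pow_left₀ (norm_nonneg _) hYle 2) (by positivity)
    have h2' : ‖b' * (t ^ (m + 1) - X ^ (m + 1))‖ ≤ ‖b'‖ * (((m + 1 : ℕ) : ℝ) * M ^ m * Y₀) := by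
      rw [norm_mul]
      refine mul_le_mul_of_nonneg_left (hR₂.trans ?_) (norm_nonneg b')
      exact mul_le_mul_of_nonneg_left hYle (by positivity)
    calc ‖junk‖ ≤ ‖b * (t ^ (m + 2) - X ^ (m + 2) - ((m + 2 : ℕ) : ℂ) * X ^ (m + 1) * Y)‖ +
          ‖b' * (t ^ (m + 1) - X ^ (m + 1))‖ + ‖ℓ₂.eval t‖ := by rw [hjunk]; exact norm_add₃_le
      _ ≤ ‖b‖ * (((m + 2 : ℕ) : ℝ) ^ 2 * M ^ m * Y₀ ^ 2) + ‖b'‖ * (((m + 1 : ℕ) : ℝ) * M ^ m * Y₀) +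
          coeffNormSum ℓ₂ * M ^ m := add_le_add (add_le_add h1' h2') hℓ₂n
      _ = (‖b‖ * ((m + 2 : ℕ) : ℝ) ^ 2 * Y₀ ^ 2 + ‖b'‖ * ((m + 1 : ℕ) : ℝ) * Y₀ +
          coeffNormSum ℓ₂) * L ^ m * ρ ^ m := by rw [hMm]; ring
  -- real parts
  have hre1 : (b * ω ^ (m + 2) * ((ρ ^ (m + 2) : ℝ) : ℂ)).re = 0 := by
    rw [Complex.re_mul_ofReal, hre0, zero_mul]
  have hre2 : (((b' + ((m + 2 : ℕ) : ℂ) * b * τ) * ω ^ (m + 1)) * ((ρ ^ (m + 1) : ℝ) : ℂ)).re =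
      ((b' + ((m + 2 : ℕ) : ℂ) * b * τ) * ω ^ (m + 1)).re * ρ ^ (m + 1) := by
    rw [Complex.re_mul_ofReal]
  have hre3 : ((((m + 2 : ℕ) : ℂ) * b * (Y - τ) * ω ^ (m + 1)) * ((ρ ^ (m + 1) : ℝ) : ℂ)).re =
      (((m + 2 : ℕ) : ℂ) * b * (Y - τ) * ω ^ (m + 1)).re * ρ ^ (m + 1) := by
    rw [Complex.re_mul_ofReal]
  have hlinY : |(((m + 2 : ℕ) : ℂ) * b * (Y - τ) * ω ^ (m + 1)).re| ≤
      ((m + 2 : ℕ) : ℝ) * ‖b‖ * ‖ω‖ ^ (m + 1) * ‖Y - τ‖ := by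
    refine (Complex.abs_re_le_norm _).trans (le_of_eq ?_)
    rw [norm_mul, norm_mul, norm_mul, norm_pow, Complex.norm_natCast]; ring
  refine ⟨?_, ?_⟩
  · rw [hsplit, Complex.add_re, Complex.add_re, Complex.add_re, hre1, hre2, hre3,
      zero_add]
    have e : ((b' + ((m + 2 : ℕ) : ℂ) * b * τ) * ω ^ (m + 1)).re * ρ ^ (m + 1) +
        (((m + 2 : ℕ) : ℂ) * b * (Y - τ) * ω ^ (m + 1)).re * ρ ^ (m + 1) + junk.re -
        ((b' + ((m + 2 : ℕ) : ℂ) * b * τ) * ω ^ (m + 1)).re * ρ ^ (m + 1) =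
        (((m + 2 : ℕ) : ℂ) * b * (Y - τ) * ω ^ (m + 1)).re * ρ ^ (m + 1) + junk.re := by ring
    rw [e]
    calc |(((m + 2 : ℕ) : ℂ) * b * (Y - τ) * ω ^ (m + 1)).re * ρ ^ (m + 1) + junk.re|
        ≤ |(((m + 2 : ℕ) : ℂ) * b * (Y - τ) * ω ^ (m + 1)).re * ρ ^ (m + 1)| + |junk.re| :=
          abs_add_le _ _
      _ ≤ ((m + 2 : ℕ) : ℝ) * ‖b‖ * ‖ω‖ ^ (m + 1) * ‖Y - τ‖ * ρ ^ (m + 1) +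
          (‖b‖ * ((m + 2 : ℕ) : ℝ) ^ 2 * Y₀ ^ 2 + ‖b'‖ * ((m + 1 : ℕ) : ℝ) * Y₀ +
            coeffNormSum ℓ₂) * L ^ m * ρ ^ m := by
          refine add_le_add ?_ ((Complex.abs_re_le_norm junk).trans hjunk_le)
          rw [abs_mul, abs_of_nonneg (by positivity : (0 : ℝ) ≤ ρ ^ (m + 1))]
          exact mul_le_mul_of_nonneg_right hlinY (by positivity)
  · calc ‖G.eval t‖ ≤ coeffNormSum G * M ^ (m + 2) := norm_eval_le_of_natDegree_le G hM1 htM hm.le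
      _ = coeffNormSum G * L ^ (m + 2) * ρ ^ (m + 2) := by rw [hM_def, mul_pow]; ring

set_option maxHeartbeats 400000 in
/-- **Logarithmically corrected roots on the ray with SUB-LEADING decay of `G` on the small
discs.**  `deg R = d ≥ 2`, `lc(R) ω^d = 2πi s`; `G` of degree `n ≥ 2` with `Re(lc(G) ω^n) = 0` and
`Re((G_{n-1} + n lc(G) τ) ω^{n-1}) < 0`, `τ = -R_{d-1}/(d lc(R))`.  Then there is a root package
as consumed by `exists_escape_zeros_log_of_roots` (file XXXIII): `e^{L} = z₀`,
`e^{R(z₀)} = e^{c₀} e^{μL}`, size bounds, `(2+3Λ)^N e^{-cΛ'} → 0`, `Re G ≤ -Λ'` on the small discs,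
together with the position `z₀(j) - (j + K₀ + 1) ω → τ`. (new) -/
theorem exists_ray_roots_log_sub (R G : Polynomial ℂ) (hd : 2 ≤ R.natDegree)
    (hn : 2 ≤ G.natDegree) (ω : ℂ) (s : ℤ) (hs : s = 1 ∨ s = -1)
    (hω : R.leadingCoeff * ω ^ R.natDegree = 2 * Real.pi * I * s)
    (hre0 : (G.leadingCoeff * ω ^ G.natDegree).re = 0)
    (hc : ((G.coeff (G.natDegree - 1) + G.natDegree * G.leadingCoeff *
      (-(R.coeff (R.natDegree - 1) / (R.natDegree * R.leadingCoeff)))) *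
        ω ^ (G.natDegree - 1)).re < 0)
    (μ : ℝ) (c₀ : ℂ) :
    ∃ (z₀ Lg : ℕ → ℂ) (Λ Λ' : ℕ → ℝ) (K₀ : ℕ), Tendsto Λ atTop atTop ∧ (∀ j, 0 ≤ Λ' j) ∧
      (∀ (N : ℕ) (c : ℝ), 0 < c →
        Tendsto (fun j => (2 + 3 * Λ j) ^ N * Real.exp (-(c * Λ' j))) atTop (𝓝 0)) ∧
      Tendsto (fun j => z₀ j - (((j + K₀ : ℕ) : ℂ) + 1) * ω) atTop
        (𝓝 (-(R.coeff (R.natDegree - 1) / (R.natDegree * R.leadingCoeff)))) ∧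
      ∀ j, exp (Lg j) = z₀ j ∧ exp (R.eval (z₀ j)) = exp c₀ * exp ((μ : ℂ) * Lg j) ∧
        1 ≤ ‖z₀ j‖ ∧ 2 ≤ ‖R.leadingCoeff‖ * ‖z₀ j‖ ∧ Λ j / 3 ≤ ‖z₀ j‖ ∧ ‖z₀ j‖ ≤ 3 * Λ j ∧
        16 ≤ ‖z₀ j‖ ∧
        ∀ z : ℂ, ‖z - z₀ j‖ ≤ 2 / (‖R.leadingCoeff‖ * ‖z₀ j‖ ^ (R.natDegree - 1)) →
          (G.eval z).re ≤ -Λ' j := by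
  obtain ⟨m, hm⟩ : ∃ m : ℕ, G.natDegree = m + 2 := ⟨G.natDegree - 2, by omega⟩
  have hm1 : G.natDegree - 1 = m + 1 := by omega
  rw [hm1, hm] at hc
  rw [hm] at hre0
  set τ : ℂ := -(R.coeff (R.natDegree - 1) / (R.natDegree * R.leadingCoeff)) with hτ_def
  set c : ℝ := ((G.coeff (m + 1) + ((m + 2 : ℕ) : ℂ) * G.leadingCoeff * τ) * ω ^ (m + 1)).re
    with hc_def
  have hc' : c < 0 := by rw [hc_def]; exact_mod_cast hc
  set a : ℂ := R.leadingCoeff with ha_def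
  set d : ℕ := R.natDegree with hd_def
  have hd1 : 1 ≤ d - 1 := by omega
  have hR0 : R ≠ 0 := by
    rintro rfl; rw [hd_def, Polynomial.natDegree_zero] at hd; omega
  have ha0 : a ≠ 0 := Polynomial.leadingCoeff_ne_zero.2 hR0
  have hapos : 0 < ‖a‖ := norm_pos_iff.2 ha0
  have hrhs : (2 * Real.pi * I * s : ℂ) ≠ 0 := by
    have hsC : (s : ℂ) ≠ 0 := by rcases hs with rfl | rfl <;> simp
    have hπ : (Real.pi : ℂ) ≠ 0 := Complex.ofReal_ne_zero.mpr Real.pi_pos.ne'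
    simp [hsC, hπ, Complex.I_ne_zero]
  have hω0 : ω ≠ 0 := by
    rintro rfl; rw [zero_pow (by omega), mul_zero] at hω; exact hrhs hω.symm
  have hωpos : 0 < ‖ω‖ := norm_pos_iff.mpr hω0
  -- the roots with their position
  obtain ⟨z₀, Lg, K₀, hz₀norm, hz₀pos, hroot⟩ := exists_ray_roots_log_pos R hd ω s hs hω μ c₀
  rw [← hτ_def] at hz₀pos
  set ρ : ℕ → ℝ := fun j => ((j + K₀ : ℕ) : ℝ) + 1 with hρ_def
  have hρC : ∀ j, (((j + K₀ : ℕ) : ℂ) + 1) = ((ρ j : ℝ) : ℂ) := fun j => by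
    rw [hρ_def]; push_cast; ring
  have hρ : Tendsto ρ atTop atTop :=
    (tendsto_natCast_add_atTop 1).comp (tendsto_add_atTop_nat K₀)
  have hρ1 : ∀ j, 1 ≤ ρ j := fun j => by
    have : (0 : ℝ) ≤ ((j + K₀ : ℕ) : ℝ) := Nat.cast_nonneg _
    simp only [hρ_def]; linarith
  -- constants of the pointwise estimate
  set nb : ℝ := ((m + 2 : ℕ) : ℝ) * ‖G.leadingCoeff‖ * ‖ω‖ ^ (m + 1) with hnb
  have hnb0 : 0 ≤ nb := by positivity
  set Kj : ℝ := (‖G.leadingCoeff‖ * ((m + 2 : ℕ) : ℝ) ^ 2 * (‖τ‖ + 1) ^ 2 +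
      ‖G.coeff (m + 1)‖ * ((m + 1 : ℕ) : ℝ) * (‖τ‖ + 1) +
      coeffNormSum (G.eraseLead - Polynomial.C (G.coeff (m + 1)) * Polynomial.X ^ (m + 1))) *
      (‖ω‖ + ‖τ‖ + 2) ^ m with hKj
  have hKj0 : 0 ≤ Kj := by
    have := coeffNormSum_nonneg (G.eraseLead - Polynomial.C (G.coeff (m + 1)) *
      Polynomial.X ^ (m + 1))
    positivity
  set η₀ : ℝ := min 1 (|c| / (4 * (nb + 1))) with hη₀
  have hcpos : 0 < |c| := abs_pos.2 hc'.ne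
  have hη₀pos : 0 < η₀ := lt_min zero_lt_one (by positivity)
  have hη₀1 : η₀ ≤ 1 := min_le_left _ _
  have hη₀c : nb * η₀ ≤ |c| / 4 := by
    have h1 : η₀ ≤ |c| / (4 * (nb + 1)) := min_le_right _ _
    calc nb * η₀ ≤ nb * (|c| / (4 * (nb + 1))) := mul_le_mul_of_nonneg_left h1 hnb0
      _ ≤ (nb + 1) * (|c| / (4 * (nb + 1))) :=
          mul_le_mul_of_nonneg_right (by linarith) (by positivity)
      _ = |c| / 4 := by field_simp
  -- eventual conditions
  have hev1 : ∀ᶠ j in atTop, ‖z₀ j - ((ρ j : ℂ) * ω + τ)‖ ≤ η₀ / 2 := by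
    have h := hz₀pos (Metric.ball_mem_nhds τ (half_pos hη₀pos))
    filter_upwards [h] with j hj
    rw [Set.mem_preimage, Metric.mem_ball, dist_eq_norm, hρC] at hj
    rw [show z₀ j - ((ρ j : ℂ) * ω + τ) = z₀ j - (ρ j : ℂ) * ω - τ by ring]
    exact hj.le
  have hev2 : ∀ᶠ j in atTop, 2 / (‖a‖ * ‖z₀ j‖ ^ (d - 1)) ≤ η₀ / 2 := by
    have hb : Tendsto (fun j => 2 / (‖a‖ * ‖z₀ j‖)) atTop (𝓝 0) :=
      tendsto_const_nhds.div_atTop (hz₀norm.const_mul_atTop hapos)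
    filter_upwards [hb (Iic_mem_nhds (half_pos hη₀pos))] with j hj
    rw [Set.mem_preimage, Set.mem_Iic] at hj
    refine le_trans ?_ hj
    have hz1 : 1 ≤ ‖z₀ j‖ := (hroot j).2.2.1
    refine div_le_div_of_nonneg_left (by norm_num) (by positivity) ?_
    refine mul_le_mul_of_nonneg_left ?_ hapos.le
    calc ‖z₀ j‖ = ‖z₀ j‖ ^ 1 := (pow_one _).symm
      _ ≤ ‖z₀ j‖ ^ (d - 1) := pow_le_pow_right₀ hz1 hd1
  have hev3 : ∀ᶠ j in atTop, 4 * Kj / |c| ≤ ρ j := hρ.eventually_ge_atTop _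
  have hev4 : ∀ᶠ j in atTop, 16 ≤ ‖z₀ j‖ := hz₀norm.eventually_ge_atTop 16
  have hev5 : ∀ᶠ j in atTop, 3 * (‖τ‖ + 1) ≤ ρ j * ‖ω‖ :=
    (hρ.atTop_mul_const hωpos).eventually_ge_atTop _
  obtain ⟨K₂, hK₂⟩ := eventually_atTop.1 (hev1.and (hev2.and (hev3.and (hev4.and hev5))))
  -- the reindexed package
  refine ⟨fun j => z₀ (j + K₂), fun j => Lg (j + K₂), fun j => ρ (j + K₂) * ‖ω‖,
    fun j => |c| / 2 * ρ (j + K₂) ^ (m + 1), K₂ + K₀, ?_, fun j => by positivity, ?_, ?_,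
    fun j => ?_⟩
  · exact (hρ.comp (tendsto_add_atTop_nat K₂)).atTop_mul_const hωpos
  · intro N c' hc'0
    have hc'' : 0 < c' * |c| / 2 := by positivity
    have hkk := hρ.comp (tendsto_add_atTop_nat K₂)
    have h0 := (tendsto_pow_mul_exp_neg_mul hc'' N).comp hkk
    have h1 : Tendsto (fun j : ℕ => (2 + 3 * ‖ω‖) ^ N *
        (ρ (j + K₂) ^ N * Real.exp (-(c' * |c| / 2 * ρ (j + K₂))))) atTop
        (𝓝 ((2 + 3 * ‖ω‖) ^ N * 0)) := h0.const_mul _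
    rw [mul_zero] at h1
    refine squeeze_zero (fun j => by positivity) (fun j => ?_) h1
    have hk1 := hρ1 (j + K₂)
    have hbase : 2 + 3 * (ρ (j + K₂) * ‖ω‖) ≤ (2 + 3 * ‖ω‖) * ρ (j + K₂) := by
      nlinarith [norm_nonneg ω]
    have hexp : Real.exp (-(c' * (|c| / 2 * ρ (j + K₂) ^ (m + 1)))) ≤
        Real.exp (-(c' * |c| / 2 * ρ (j + K₂))) := by
      refine Real.exp_le_exp.2 (neg_le_neg ?_)
      have hp : ρ (j + K₂) ≤ ρ (j + K₂) ^ (m + 1) := by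
        calc ρ (j + K₂) = ρ (j + K₂) ^ 1 := (pow_one _).symm
          _ ≤ ρ (j + K₂) ^ (m + 1) := pow_le_pow_right₀ hk1 (by omega)
      have : c' * |c| / 2 * ρ (j + K₂) ≤ c' * |c| / 2 * ρ (j + K₂) ^ (m + 1) :=
        mul_le_mul_of_nonneg_left hp hc''.le
      linarith
    calc (2 + 3 * (ρ (j + K₂) * ‖ω‖)) ^ N * Real.exp (-(c' * (|c| / 2 * ρ (j + K₂) ^ (m + 1))))
        ≤ ((2 + 3 * ‖ω‖) * ρ (j + K₂)) ^ N * Real.exp (-(c' * |c| / 2 * ρ (j + K₂))) :=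
          mul_le_mul (pow_le_pow_left₀ (by positivity) hbase N) hexp (Real.exp_nonneg _)
            (by positivity)
      _ = (2 + 3 * ‖ω‖) ^ N * (ρ (j + K₂) ^ N * Real.exp (-(c' * |c| / 2 * ρ (j + K₂)))) := by
          rw [mul_pow]; ring
  · have h := hz₀pos.comp (tendsto_add_atTop_nat K₂)
    refine h.congr fun j => ?_
    simp only [Function.comp_apply]
    rw [show j + K₂ + K₀ = j + (K₂ + K₀) by omega]
  · obtain ⟨h1, h2, h3, h4, h5⟩ := hK₂ (j + K₂) (Nat.le_add_left _ _)
    obtain ⟨hLz, hz₀e, hz₀1, hz₀2⟩ := hroot (j + K₂)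
    have hρj := hρ1 (j + K₂)
    have hρ0 : 0 ≤ ρ (j + K₂) := zero_le_one.trans hρj
    -- `‖z₀ - ρω‖ ≤ ‖τ‖ + 1`
    have hdev : ‖z₀ (j + K₂) - (ρ (j + K₂) : ℂ) * ω‖ ≤ ‖τ‖ + 1 := by
      have e : z₀ (j + K₂) - (ρ (j + K₂) : ℂ) * ω =
          (z₀ (j + K₂) - ((ρ (j + K₂) : ℂ) * ω + τ)) + τ := by ring
      rw [e]
      refine (norm_add_le _ _).trans ?_
      linarith [hη₀1]
    have hXnorm : ‖(ρ (j + K₂) : ℂ) * ω‖ = ρ (j + K₂) * ‖ω‖ := by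
      rw [norm_mul, Complex.norm_real, Real.norm_eq_abs, abs_of_nonneg hρ0]
    refine ⟨hLz, hz₀e, hz₀1, hz₀2, ?_, ?_, h4, fun z hz => ?_⟩
    · -- `ρ‖ω‖/3 ≤ ‖z₀‖`
      have := norm_sub_norm_le ((ρ (j + K₂) : ℂ) * ω) (z₀ (j + K₂))
      rw [norm_sub_rev, hXnorm] at this
      linarith
    · have := norm_le_insert' (z₀ (j + K₂)) ((ρ (j + K₂) : ℂ) * ω)
      rw [hXnorm] at this
      linarith
    · -- the sub-leading decay on the small disc
      set Y : ℂ := z - (ρ (j + K₂) : ℂ) * ω with hY_def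
      have hzY : z = (ρ (j + K₂) : ℂ) * ω + Y := by rw [hY_def]; ring
      have hYτ : ‖Y - τ‖ ≤ η₀ := by
        have e : Y - τ = (z - z₀ (j + K₂)) + (z₀ (j + K₂) - ((ρ (j + K₂) : ℂ) * ω + τ)) := by
          rw [hY_def]; ring
        rw [e]
        refine (norm_add_le _ _).trans ?_
        linarith [hz.trans h2]
      obtain ⟨hpt, -⟩ := abs_re_eval_sub_le_of_subleading G hm ω τ hre0 hρj (hYτ.trans hη₀1)
      rw [← hzY, ← hc_def, ← hnb, ← hKj] at hpt
      have hlin : nb * ‖Y - τ‖ * ρ (j + K₂) ^ (m + 1) ≤ |c| / 4 * ρ (j + K₂) ^ (m + 1) := by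
        refine mul_le_mul_of_nonneg_right ?_ (by positivity)
        exact (mul_le_mul_of_nonneg_left hYτ hnb0).trans hη₀c
      have hKρ : Kj * ρ (j + K₂) ^ m ≤ |c| / 4 * ρ (j + K₂) ^ (m + 1) := by
        have h3' : Kj ≤ |c| / 4 * ρ (j + K₂) := by
          rw [div_le_iff₀ hcpos] at h3; linarith
        calc Kj * ρ (j + K₂) ^ m ≤ (|c| / 4 * ρ (j + K₂)) * ρ (j + K₂) ^ m :=
            mul_le_mul_of_nonneg_right h3' (by positivity)
          _ = |c| / 4 * ρ (j + K₂) ^ (m + 1) := by ring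
      have habs := (abs_le.1 (hpt.trans (add_le_add hlin hKρ))).2
      have hcabs : |c| = -c := abs_of_neg hc'
      rw [hcabs] at habs ⊢
      nlinarith [pow_nonneg hρ0 (m + 1)]

end Summit.Schanuel.Schanuel.Theorems
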